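import Mathlib.Logic.Equiv.List
import Mathlib.Logic.Denumerable
import Mathlib.Data.Nat.Pairing
import Literature.ModelTheory.ExponentialFields.DecidableTheory
import Literature.ModelTheory.ProofTheory.PreSyntax

/-!
# Numeric codes of pre-syntax; Mathlib's Gödel numbering letter by letter

Support file for the proof of the enumerability theorem
(`FirstOrder.Language.Theory.IsComputablyAxiomatizable.isRE`,
`Literature/ModelTheory/ExponentialFields/DecidableTheory.lean`; Enderton, *A Mathematical
Introduction to Logic*, §3.4 "arithmetization of syntax", §3.5 Thm. 35I). It fixes

* *bijective* `ℕ`-codes of the pre-terms and pre-formulas of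
  `Literature/ModelTheory/ProofTheory/PreSyntax.lean` (`PreTerm.code`, `PreFormula.code`) together
  with total decoders `PreTerm.ofNat`, `PreFormula.ofNat` and the arithmetic of the numeric
  constructors `varC, paramC, funcC, consC, equalC, relC, impC, allC` (`nil` and `falsum` are `0`).
  Because decoding is total and inverts every numeric constructor identically
  (`PreTerm.ofNat_funcC` …), the proof checker of
  `Literature/ModelTheory/ProofTheory/Checker.lean` (meaning of judgements in
  `CheckerSoundness.lean`) can state the meaning of its judgements
  about *arbitrary* naturals, with no well-formedness bookkeeping;
* the arithmetic of Mathlib's concrete Gödel numbering `Sentence.godelNumber = Encodable.encode`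
  (`DecidableTheory.lean`, built from `Term.listEncode` / `BoundedFormula.listEncode` and the
  `Encodable` instances for lists, sums, sigma types and `Fin`): the *letters* of a term
  (`termLetters`) and of a bounded formula (`formulaLetters`) as explicit lists of naturals,
  computed constructor by constructor (`termLetters_var` … `formulaLetters_all`), and
  `encode φ = encode (formulaLetters φ)` for sentences (`encode_sentence_eq`).

## References

* H. B. Enderton, *A Mathematical Introduction to Logic*, Academic Press (1972), §3.4.
* Mathlib, `Mathlib/ModelTheory/Encoding.lean`, `Mathlib/Logic/Encodable/Basic.lean`,
  `Mathlib/Logic/Equiv/List.lean`.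
-/

namespace Literature.ModelTheory.ProofTheory.PreFOL

open FirstOrder FirstOrder.Language Encodable Denumerable

/-! ### Numeric constructors -/

/-- Code of the variable of level `i`: `4 i + 1`. [folklore] -/
def varC (i : ℕ) : ℕ := 4 * i + 1

/-- Code of the parameter `c`: `4 c + 2`. [folklore] -/
def paramC (c : ℕ) : ℕ := 4 * c + 2

/-- Code of an application `func f a`: `4 ⟪f, a⟫ + 3`. [folklore] -/
def funcC (f a : ℕ) : ℕ := 4 * Nat.pair f a + 3

/-- Code of an argument list `cons t r`: `4 ⟪t, r⟫ + 4` (`nil` is coded by `0`). [folklore] -/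
def consC (t r : ℕ) : ℕ := 4 * Nat.pair t r + 4

/-- Code of an equation `equal a b`: `4 ⟪a, b⟫ + 1` (`falsum` is coded by `0`). [folklore] -/
def equalC (a b : ℕ) : ℕ := 4 * Nat.pair a b + 1

/-- Code of an atomic relation `rel r a`: `4 ⟪r, a⟫ + 2`. [folklore] -/
def relC (r a : ℕ) : ℕ := 4 * Nat.pair r a + 2

/-- Code of an implication `imp a b`: `4 ⟪a, b⟫ + 3`. [folklore] -/
def impC (a b : ℕ) : ℕ := 4 * Nat.pair a b + 3

/-- Code of a universal formula `all a`: `4 a + 4`. [folklore] -/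
def allC (a : ℕ) : ℕ := 4 * a + 4

/-- Code of a negation `not a = imp a falsum`. [folklore] -/
abbrev notC (a : ℕ) : ℕ := impC a 0

/-! ### Codes and decoding of pre-terms -/

namespace PreTerm

/-- The code of a pre-term (a bijection onto `ℕ`, see `PreTerm.ofNat_code`, `PreTerm.code_ofNat`).
[folklore] -/
def code : PreTerm → ℕ
  | var i => varC i
  | param c => paramC c
  | func f a => funcC f a.code
  | nil => 0
  | cons t r => consC t.code r.code

/-- The total decoder of pre-terms: `n = 0` is `nil`, otherwise `(n - 1) % 4` selects the
constructor and `(n - 1) / 4` carries the (paired) arguments. [folklore] -/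
def ofNat (n : ℕ) : PreTerm :=
  if n = 0 then nil
  else if (n - 1) % 4 = 0 then var ((n - 1) / 4)
  else if (n - 1) % 4 = 1 then param ((n - 1) / 4)
  else if (n - 1) % 4 = 2 then
    func ((n - 1) / 4).unpair.1 (ofNat ((n - 1) / 4).unpair.2)
  else cons (ofNat ((n - 1) / 4).unpair.1) (ofNat ((n - 1) / 4).unpair.2)
termination_by n
decreasing_by
  · exact lt_of_le_of_lt (Nat.unpair_right_le _) (by omega)
  · exact lt_of_le_of_lt (Nat.unpair_left_le _) (by omega)
  · exact lt_of_le_of_lt (Nat.unpair_right_le _) (by omega)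

/-- Decoding `0`. [folklore] -/
@[simp] theorem ofNat_zero : ofNat 0 = nil := by
  rw [ofNat]; simp

/-- Decoding a variable code. [folklore] -/
@[simp] theorem ofNat_varC (i : ℕ) : ofNat (varC i) = var i := by
  rw [ofNat]
  simp [varC]

/-- Decoding a parameter code. [folklore] -/
@[simp] theorem ofNat_paramC (c : ℕ) : ofNat (paramC c) = param c := by
  rw [ofNat]
  simp [paramC]
  omega

/-- Decoding an application code. [folklore] -/
@[simp] theorem ofNat_funcC (f a : ℕ) : ofNat (funcC f a) = func f (ofNat a) := by
  rw [ofNat]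
  have h : (4 * Nat.pair f a + 2) / 4 = Nat.pair f a := by omega
  simp [funcC, h]

/-- Decoding an argument-list code. [folklore] -/
@[simp] theorem ofNat_consC (t r : ℕ) : ofNat (consC t r) = cons (ofNat t) (ofNat r) := by
  rw [ofNat]
  have h : (4 * Nat.pair t r + 3) / 4 = Nat.pair t r := by omega
  simp [consC, h]

/-- `ofNat` is a left inverse of `code`. [folklore] -/
@[simp] theorem ofNat_code : ∀ t : PreTerm, ofNat t.code = t
  | var i => ofNat_varC i
  | param c => ofNat_paramC c
  | func f a => by rw [code, ofNat_funcC, ofNat_code a]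
  | nil => ofNat_zero
  | cons t r => by rw [code, ofNat_consC, ofNat_code t, ofNat_code r]

/-- `code` is injective. [folklore] -/
theorem code_injective : Function.Injective code := fun t t' h => by
  rw [← ofNat_code t, ← ofNat_code t', h]

/-- `ofNat` is a right inverse of `code`: the coding is a bijection `PreTerm ≃ ℕ`. [folklore] -/
theorem code_ofNat (n : ℕ) : (ofNat n).code = n := by
  induction n using Nat.strong_induction_on with
  | _ n ih =>
    rcases Nat.eq_zero_or_pos n with rfl | hn
    · simp [code]
    · obtain ⟨m, rfl⟩ : ∃ m, n = m + 1 := ⟨n - 1, by omega⟩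
      obtain ⟨q, r, hr, rfl⟩ : ∃ q r, r < 4 ∧ m = 4 * q + r := ⟨m / 4, m % 4, Nat.mod_lt _ (by omega), by omega⟩
      have hq : q < 4 * q + r + 1 := by omega
      have hq1 : q.unpair.1 < 4 * q + r + 1 := lt_of_le_of_lt (Nat.unpair_left_le _) hq
      have hq2 : q.unpair.2 < 4 * q + r + 1 := lt_of_le_of_lt (Nat.unpair_right_le _) hq
      have hdiv : (4 * q + r) / 4 = q := by omega
      have hmod : (4 * q + r) % 4 = r := by omega
      rw [ofNat]
      simp only [Nat.add_one_ne_zero, ↓reduceIte, Nat.add_sub_cancel, hdiv, hmod]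
      rcases (by omega : r = 0 ∨ r = 1 ∨ r = 2 ∨ r = 3) with rfl | rfl | rfl | rfl
      · simp [code, varC]
      · simp [code, paramC]
      · simp [code, funcC, ih _ hq2]
      · simp [code, consC, ih _ hq1, ih _ hq2]

end PreTerm

/-! ### Codes and decoding of pre-formulas -/

namespace PreFormula

/-- The code of a pre-formula (a bijection onto `ℕ`). [folklore] -/
def code : PreFormula → ℕ
  | falsum => 0
  | equal t₁ t₂ => equalC t₁.code t₂.code
  | rel r a => relC r a.code
  | imp φ ψ => impC φ.code ψ.code
  | all φ => allC φ.code

/-- The total decoder of pre-formulas. [folklore] -/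
def ofNat (n : ℕ) : PreFormula :=
  if n = 0 then falsum
  else if (n - 1) % 4 = 0 then
    equal (PreTerm.ofNat ((n - 1) / 4).unpair.1) (PreTerm.ofNat ((n - 1) / 4).unpair.2)
  else if (n - 1) % 4 = 1 then rel ((n - 1) / 4).unpair.1 (PreTerm.ofNat ((n - 1) / 4).unpair.2)
  else if (n - 1) % 4 = 2 then imp (ofNat ((n - 1) / 4).unpair.1) (ofNat ((n - 1) / 4).unpair.2)
  else all (ofNat ((n - 1) / 4))
termination_by n
decreasing_by
  · exact lt_of_le_of_lt (Nat.unpair_left_le _) (by omega)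
  · exact lt_of_le_of_lt (Nat.unpair_right_le _) (by omega)
  · omega

/-- Decoding `0`. [folklore] -/
@[simp] theorem ofNat_zero : ofNat 0 = falsum := by
  rw [ofNat]; simp

/-- Decoding an equation code. [folklore] -/
@[simp] theorem ofNat_equalC (a b : ℕ) :
    ofNat (equalC a b) = equal (PreTerm.ofNat a) (PreTerm.ofNat b) := by
  rw [ofNat]
  simp [equalC]

/-- Decoding an atomic-relation code. [folklore] -/
@[simp] theorem ofNat_relC (r a : ℕ) : ofNat (relC r a) = rel r (PreTerm.ofNat a) := by
  rw [ofNat]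
  have h : (4 * Nat.pair r a + 1) / 4 = Nat.pair r a := by omega
  simp [relC, h]

/-- Decoding an implication code. [folklore] -/
@[simp] theorem ofNat_impC (a b : ℕ) : ofNat (impC a b) = imp (ofNat a) (ofNat b) := by
  rw [ofNat]
  have h : (4 * Nat.pair a b + 2) / 4 = Nat.pair a b := by omega
  simp [impC, h]

/-- Decoding a universal-formula code. [folklore] -/
@[simp] theorem ofNat_allC (a : ℕ) : ofNat (allC a) = all (ofNat a) := by
  rw [ofNat]
  have h : (4 * a + 3) / 4 = a := by omega
  simp [allC, h]

/-- `ofNat` is a left inverse of `code`. [folklore] -/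
@[simp] theorem ofNat_code : ∀ φ : PreFormula, ofNat φ.code = φ
  | falsum => ofNat_zero
  | equal t₁ t₂ => by rw [code, ofNat_equalC, PreTerm.ofNat_code, PreTerm.ofNat_code]
  | rel r a => by rw [code, ofNat_relC, PreTerm.ofNat_code]
  | imp φ ψ => by rw [code, ofNat_impC, ofNat_code φ, ofNat_code ψ]
  | all φ => by rw [code, ofNat_allC, ofNat_code φ]

/-- `code` is injective. [folklore] -/
theorem code_injective : Function.Injective code := fun φ φ' h => by
  rw [← ofNat_code φ, ← ofNat_code φ', h]

/-- `ofNat` is a right inverse of `code`: the coding is a bijection `PreFormula ≃ ℕ`. [folklore] -/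
theorem code_ofNat (n : ℕ) : (ofNat n).code = n := by
  induction n using Nat.strong_induction_on with
  | _ n ih =>
    rcases Nat.eq_zero_or_pos n with rfl | hn
    · simp [code]
    · obtain ⟨m, rfl⟩ : ∃ m, n = m + 1 := ⟨n - 1, by omega⟩
      obtain ⟨q, r, hr, rfl⟩ : ∃ q r, r < 4 ∧ m = 4 * q + r := ⟨m / 4, m % 4, Nat.mod_lt _ (by omega), by omega⟩
      have hq : q < 4 * q + r + 1 := by omega
      have hq1 : q.unpair.1 < 4 * q + r + 1 := lt_of_le_of_lt (Nat.unpair_left_le _) hq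
      have hq2 : q.unpair.2 < 4 * q + r + 1 := lt_of_le_of_lt (Nat.unpair_right_le _) hq
      have hdiv : (4 * q + r) / 4 = q := by omega
      have hmod : (4 * q + r) % 4 = r := by omega
      rw [ofNat]
      simp only [Nat.add_one_ne_zero, ↓reduceIte, Nat.add_sub_cancel, hdiv, hmod]
      rcases (by omega : r = 0 ∨ r = 1 ∨ r = 2 ∨ r = 3) with rfl | rfl | rfl | rfl
      · simp [code, equalC, PreTerm.code_ofNat]
      · simp [code, relC, PreTerm.code_ofNat]
      · simp [code, impC, ih _ hq1, ih _ hq2]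
      · simp [code, allC, ih _ hq]

/-- The code of a negation. [folklore] -/
theorem code_not (φ : PreFormula) : (not φ).code = notC φ.code := rfl

end PreFormula

/-! ### Mathlib's Gödel numbering, letter by letter -/

section MathlibCodes

variable {L : Language} [Encodable (Σ i, L.Functions i)] [Encodable (Σ i, L.Relations i)]

/-- A list is encoded as the list of the codes of its entries. [folklore] -/
theorem encode_list_map {α : Type*} [Encodable α] (l : List α) : encode l = encode (l.map encode) := by
  induction l with
  | nil => rfl
  | cons a l ih => simp [ih]

/-- The code of `i : Fin k` is `i`. [folklore] -/
theorem encode_fin {k : ℕ} (i : Fin k) : encode i = i.val := rfl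

/-- The *letters* of a Mathlib term: the codes of the entries of `Term.listEncode`. [folklore] -/
def termLetters {k : ℕ} (t : L.Term (Empty ⊕ Fin k)) : List ℕ :=
  (Term.listEncode t).map encode

omit [Encodable (Σ i, L.Relations i)] in
/-- The code of a term is the code of its list of letters. [folklore] -/
theorem encode_term_eq {k : ℕ} (t : L.Term (Empty ⊕ Fin k)) : encode t = encode (termLetters t) := by
  rw [termLetters, ← encode_list_map]; rfl

omit [Encodable (Σ i, L.Relations i)] in
/-- The list decoded from the code of a term is its list of letters. [folklore] -/
@[simp] theorem ofNat_encode_term {k : ℕ} (t : L.Term (Empty ⊕ Fin k)) :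
    ofNat (List ℕ) (encode t) = termLetters t := by
  rw [encode_term_eq, Denumerable.ofNat_encode]

omit [Encodable (Σ i, L.Relations i)] in
/-- Letters of a variable: the single letter `4 i + 2`. [folklore] -/
@[simp] theorem termLetters_var {k : ℕ} (i : Fin k) :
    termLetters (Term.var (Sum.inr i) : L.Term (Empty ⊕ Fin k)) = [4 * i.val + 2] := by
  simp [termLetters, Term.listEncode, encode_fin]; omega

omit [Encodable (Σ i, L.Relations i)] in
/-- Letters of an application: the letter `2 f + 1` of the function symbol followed by the
letters of the arguments. [folklore] -/
@[simp] theorem termLetters_func {k n : ℕ} (F : L.Functions n) (ts : Fin n → L.Term (Empty ⊕ Fin k)) :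
    termLetters (Term.func F ts) =
      (2 * encode (⟨n, F⟩ : Σ i, L.Functions i) + 1) :: (List.ofFn fun i => termLetters (ts i)).flatten := by
  simp only [termLetters, Term.listEncode, List.map_cons, encode_inr, List.cons.injEq, true_and]
  rw [List.flatMap_def, List.map_flatten, List.map_map, ← List.ofFn_eq_map]
  rfl

/-- The *letters* of a Mathlib bounded formula: the codes of the entries of
`BoundedFormula.listEncode`. [folklore] -/
def formulaLetters {k : ℕ} (φ : L.BoundedFormula Empty k) : List ℕ :=
  (BoundedFormula.listEncode φ).map encode

/-- Letters of `⊥` at depth `k`: the single letter `4 (k + 2) + 3 = 4 k + 11`. [folklore] -/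
@[simp] theorem formulaLetters_falsum {k : ℕ} :
    formulaLetters (BoundedFormula.falsum : L.BoundedFormula Empty k) = [4 * k + 11] := by
  simp [formulaLetters, BoundedFormula.listEncode]; omega

/-- Letters of an equation at depth `k`: the two letters `2 ⟨k, ⌜tᵢ⌝⟩`. [folklore] -/
@[simp] theorem formulaLetters_equal {k : ℕ} (t₁ t₂ : L.Term (Empty ⊕ Fin k)) :
    formulaLetters (BoundedFormula.equal t₁ t₂) =
      [2 * Nat.pair k (encode t₁), 2 * Nat.pair k (encode t₂)] := by
  simp [formulaLetters, BoundedFormula.listEncode]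

/-- Letters of an atomic relation at depth `k`: `4 r + 1`, `4 k + 3`, then the letters
`2 ⟨k, ⌜tᵢ⌝⟩` of the arguments. [folklore] -/
@[simp] theorem formulaLetters_rel {k n : ℕ} (R : L.Relations n) (ts : Fin n → L.Term (Empty ⊕ Fin k)) :
    formulaLetters (BoundedFormula.rel R ts) =
      (4 * encode (⟨n, R⟩ : Σ i, L.Relations i) + 1) :: (4 * k + 3) ::
        List.ofFn fun i => 2 * Nat.pair k (encode (ts i)) := by
  simp only [formulaLetters, BoundedFormula.listEncode, List.cons_append, List.nil_append,
    List.map_cons, List.map_map, encode_inr, encode_inl, encode_nat, List.cons.injEq]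
  refine ⟨by omega, by omega, ?_⟩
  rw [← List.ofFn_eq_map]
  rfl

/-- Letters of an implication: `3`, the letters of the antecedent, the letters of the
consequent. [folklore] -/
@[simp] theorem formulaLetters_imp {k : ℕ} (φ ψ : L.BoundedFormula Empty k) :
    formulaLetters (BoundedFormula.imp φ ψ) = 3 :: (formulaLetters φ ++ formulaLetters ψ) := by
  simp [formulaLetters, BoundedFormula.listEncode]

/-- Letters of a universal formula: `7`, then the letters of the body. [folklore] -/
@[simp] theorem formulaLetters_all {k : ℕ} (φ : L.BoundedFormula Empty (k + 1)) :
    formulaLetters (BoundedFormula.all φ) = 7 :: formulaLetters φ := by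
  simp [formulaLetters, BoundedFormula.listEncode]

/-- **The Gödel number of a sentence** (`Sentence.godelNumber = encode` of
`DecidableTheory.lean`) is the code of its list of letters. [folklore] -/
theorem encode_sentence_eq (φ : L.Sentence) : encode φ = encode (formulaLetters φ) := by
  rw [formulaLetters, ← encode_list_map]; rfl

/-- The Gödel number of a sentence is the code of its list of letters. [folklore] -/
theorem godelNumber_eq (φ : L.Sentence) : φ.godelNumber = encode (formulaLetters φ) :=
  encode_sentence_eq φ

/-- Two bounded formulas of the same depth with the same letters are equal. [folklore] -/
theorem formulaLetters_injective {k : ℕ} :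
    Function.Injective (formulaLetters : L.BoundedFormula Empty k → List ℕ) := by
  intro φ ψ h
  have h' : BoundedFormula.listEncode φ = BoundedFormula.listEncode ψ :=
    List.map_injective_iff.2 encode_injective h
  have := BoundedFormula.listEncode_sigma_injective (L := L) (α := Empty)
    (a₁ := ⟨k, φ⟩) (a₂ := ⟨k, ψ⟩) h'
  simpa using this

end MathlibCodes

end Literature.ModelTheory.ProofTheory.PreFOL
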